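import Mathlib
import Summits.NavierStokesRegularity.NavierStokesRegularity.Theorems.EulerZoomLiouvillePowerGaugeEulerLiouvilleSelfSimilarBernoulliSqueezeVortical
import HarnessLib

/-!
# «PINCHED VORTICAL CHANNELS SQUEEZE VOLUME TOO FAST» — the (C2) volume squeeze WITHOUT ANY GROWTH HYPOTHESIS
# (crux `EulerZoomLiouville.PowerGaugeEulerLiouville` = stmt-NavierStokesRegularity-19832, line `birth`, THE ONE STATEMENT; LEAD's RESIDUE-MEMO-19832-g12 target T3)

Route №10 `EulerZoomLiouville` (NavierStokesRegularity); width seat ns-ezl-w5 g2.  The seat's g0 vortical squeeze `Loc.curl_eq_zero_of_vorticalFastChannel_of_thin`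
(p635086) used the GLOBAL linear growth `‖U y‖ ≤ K₁(1+‖y‖)` only to keep the backward orbits of the blob inside the big ball where the cut-off field is the profile
field.  HERE the growth is asked only where it is used: as an UPPER radial similarity inflow rate `−K₁‖y‖² ≤ ⟪y, γy + U y⟫` at the far VORTICAL points of the high
set — the same points where the channel's LOWER rate `⟪y, γy + U y⟫ ≤ −c₁‖y‖²` is asked.  The first-exit argument runs on the joint predicate «not closer than the
start AND inside the big ball»: on a good interval the cut-off orbit is a true orbit, hence Bernoulli-high (`ℋ` non-decreasing backward), vortical (Cauchy), far; both
rates apply, the lower one gives `‖Y(t)‖ ≥ ‖y‖e^{c₁t}`, the upper one `‖Y(t)‖ ≤ ‖y‖e^{K₁t} ≤ R_big − 2`; continuity pushes the exit time past `T`; volume law and race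
`3γ < c₁ m` as before.

* **`Loc.curl_eq_zero_of_pinchedVorticalChannel_of_thin`** — `(U,P)` a `C²` CIV (3.3) profile, `0 < γ < ½`; high sets thin with rate `m` far out; for every level
  `h`: `R₀`, `K₁` with `−K₁‖y‖² ≤ ⟪y, γy+Uy⟫ ≤ −c₁‖y‖²` at every vortical point of `{ℋ > h}` beyond `R₀`; `3γ < c₁ m` ⇒ `curl U ≡ 0`.  NO growth hypothesis.
With the growth-free Sobolev thinness `m = 3+3ρ` (`…SqueezeSobolevFree*`), the member corollary (`…SqueezePinchedMember`): radial inflow rate on the far vortical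
high set pinched in SOME window `[c₁, K₁]`, `c₁ > 1/((2+ρ)(1+ρ))` ⇒ trivial; «super-linear growth of `V` somewhere» leaves THE ONE STATEMENT.
HONEST LABEL: a dynamical sub-stratum of THE ONE STATEMENT.  WHAT THIS IS NOT: not NS, not E — 19832 is a crux CLASS on the MODEL lattice (E/NS strata) and stays
OPEN; NS regularity is NOT proved. [folklore; ConstantinIgnatovaVicol2026Putative §3.4.1 (3.21)–(3.22), §3.4.3 (3.30)–(3.33)]
-/

noncomputable section

-- flat `Theorems/<Route><Decl>…` files of one crux share the namespace of the crux (tree convention)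
set_option linter.dupNamespace false

open MeasureTheory Set Filter Topology Metric Function InnerProductSpace
open scoped RealInnerProductSpace NNReal ENNReal ContDiff

namespace Summit.NavierStokesRegularity.NavierStokesRegularity.Theorems.PowerGaugeEulerLiouville.Loc

open Literature.Analysis Literature.Analysis.FluidPDE
open Summit.NavierStokesRegularity.NavierStokesRegularity.Theorems.PowerGaugeEulerLiouville.BernoulliLandscape
open Summit.NavierStokesRegularity.NavierStokesRegularity.Theorems.PowerGaugeEulerLiouville.BackwardEscape
open Summit.NavierStokesRegularity.NavierStokesRegularity.Theorems.PowerGaugeEulerLiouville.NodalFiniteness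

variable {γ : ℝ} {U : EuclideanSpace ℝ (Fin 3) → EuclideanSpace ℝ (Fin 3)} {P : EuclideanSpace ℝ (Fin 3) → ℝ}

/-! ### The squeeze, pinched form: no growth hypothesis -/

set_option maxHeartbeats 800000 in
/-- **PINCHED VORTICAL CHANNELS SQUEEZE VOLUME TOO FAST — no growth hypothesis.**  As `Loc.curl_eq_zero_of_vorticalFastChannel_of_thin` (p635086), but the
global linear growth `‖U y‖ ≤ K₁(1+‖y‖)` is REPLACED by an upper radial rate on the same set where the channel is asked: for every level `h` there are `R₀`,
`K₁` such that every VORTICAL point of `{ℋ > h}` with `‖y‖ ≥ R₀` has `−K₁‖y‖² ≤ ⟪y, γy + U y⟫ ≤ −c₁‖y‖²` (radial similarity inflow rate PINCHED in `[c₁, K₁]`).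
The backward orbit of a far vortical Bernoulli-high point is followed by a first-exit argument whose «good» predicate now includes staying in the big ball
where the cut-off field is the profile field: on a good interval the orbit is a TRUE orbit, hence stays Bernoulli-high (`ℋ` monotone backward), vortical (Cauchy),
far, so BOTH radial bounds apply — the lower one gives the escape `‖Y(t)‖ ≥ ‖y‖e^{c₁t}`, the upper one `‖Y(t)‖ ≤ ‖y‖e^{K₁t}` keeps it in the big ball; the exit
time is pushed past `T` by continuity.  With thinness rate `m` of the high sets and the race `3γ < c₁ m`, `curl U ≡ 0`. [folklore; ConstantinIgnatovaVicol2026Putative §3.4] -/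
theorem curl_eq_zero_of_pinchedVorticalChannel_of_thin (hprof : IsSelfSimilarEulerProfile γ 0 U P) (hγ : 0 < γ) (hγ2 : γ < 1 / 2)
    {m c₁ : ℝ} (hc₁ : 0 < c₁) (hrace : 3 * γ < c₁ * m)
    (hthin : ∀ h : ℝ, ∃ C R₂ : ℝ, 0 < R₂ ∧ ∀ R : ℝ, R₂ ≤ R →
      volume ({y : EuclideanSpace ℝ (Fin 3) | h < selfSimilarBernoulli γ 0 U P y} ∩ {y | R ≤ ‖y‖}) ≤
        ENNReal.ofReal (C * R ^ (-m)))
    (hfast : ∀ h : ℝ, ∃ R₀ K₁ : ℝ, ∀ y : EuclideanSpace ℝ (Fin 3), R₀ ≤ ‖y‖ → h < selfSimilarBernoulli γ 0 U P y →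
      curl U y ≠ 0 → ⟪y, selfSimilarTransport γ 0 U y⟫ ≤ -(c₁ * ‖y‖ ^ 2) ∧
        -(K₁ * ‖y‖ ^ 2) ≤ ⟪y, selfSimilarTransport γ 0 U y⟫)
    (x₀ : EuclideanSpace ℝ (Fin 3)) : curl U x₀ = 0 := by
  -- adapted from `Loc.curl_eq_zero_of_vorticalFastChannel_of_thin` (…SelfSimilarBernoulliSqueezeVortical, ns-ezl-w5 g0)
  by_contra hx₀
  set Hb : EuclideanSpace ℝ (Fin 3) → ℝ := selfSimilarBernoulli γ 0 U P with hHb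
  have hHc : Continuous Hb := hprof.contDiff_selfSimilarBernoulli.continuous
  have hγ2' : γ ≤ 1 / 2 := hγ2.le
  set h : ℝ := Hb x₀ - 1 with hh
  obtain ⟨C, R₂, hR₂, hthinR⟩ := hthin h
  obtain ⟨R₀, K₁, hfastR⟩ := hfast h
  set C' : ℝ := max C 0 with hC'
  have hC'0 : 0 ≤ C' := le_max_right _ _
  have hthinR' : ∀ R : ℝ, R₂ ≤ R →
      volume ({y : EuclideanSpace ℝ (Fin 3) | h < Hb y} ∩ {y | R ≤ ‖y‖}) ≤ ENNReal.ofReal (C' * R ^ (-m)) :=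
    fun R hR => (hthinR R hR).trans (ENNReal.ofReal_le_ofReal
      (mul_le_mul_of_nonneg_right (le_max_left _ _) (Real.rpow_nonneg (hR₂.le.trans hR) _)))
  set R : ℝ := max (max R₀ R₂) (max ‖x₀‖ 1) + 1 with hRdef
  have hRR₀ : R₀ ≤ R - 1 := by rw [hRdef]; linarith [le_max_left R₀ R₂, le_max_left (max R₀ R₂) (max ‖x₀‖ 1)]
  have hRR₂ : R₂ ≤ R - 1 := by rw [hRdef]; linarith [le_max_right R₀ R₂, le_max_left (max R₀ R₂) (max ‖x₀‖ 1)]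
  have hR1 : 1 ≤ R - 1 := by rw [hRdef]; linarith [le_max_right ‖x₀‖ 1, le_max_right (max R₀ R₂) (max ‖x₀‖ 1)]
  have hRx₀ : ‖x₀‖ < R := by rw [hRdef]; linarith [le_max_left ‖x₀‖ 1, le_max_right (max R₀ R₂) (max ‖x₀‖ 1)]
  have hR0 : 0 < R - 1 := by linarith
  have hhx₀ : h < Hb x₀ := by rw [hh]; linarith
  obtain ⟨y₀, hy₀R, -, hy₀curl, hy₀h⟩ := exists_fastInflow_vortical_bernoulli_gt hprof hγ hγ2 hx₀ hhx₀ hRx₀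
  have hcurlc : Continuous (curl U) := (differentiable_curl_of_contDiff hprof.contDiff_velocity).continuous
  have hO : IsOpen ({y : EuclideanSpace ℝ (Fin 3) | h < Hb y} ∩ {y | curl U y ≠ 0}) :=
    (isOpen_lt continuous_const hHc).inter (isOpen_ne_fun hcurlc continuous_const)
  obtain ⟨ε, hε, hεsub⟩ := Metric.isOpen_iff.1 hO y₀ ⟨hy₀h, hy₀curl⟩
  set r : ℝ := min ε 1 / 2 with hr
  have hr0 : 0 < r := by rw [hr]; positivity
  have hrε : r < ε := by rw [hr]; linarith [min_le_left ε 1]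
  have hr1 : r < 1 := by rw [hr]; linarith [min_le_right ε 1]
  set A : Set (EuclideanSpace ℝ (Fin 3)) := ball y₀ r with hA
  have hAm : MeasurableSet A := measurableSet_ball
  have hAh : ∀ y ∈ A, h < Hb y := fun y hy => (hεsub (ball_subset_ball hrε.le hy)).1
  have hAcurl : ∀ y ∈ A, curl U y ≠ 0 := fun y hy => (hεsub (ball_subset_ball hrε.le hy)).2
  have hAR : ∀ y ∈ A, R - 1 < ‖y‖ := fun y hy => by
    have h1 : ‖y₀‖ - ‖y‖ ≤ ‖y₀ - y‖ := norm_sub_norm_le y₀ y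
    rw [hA, mem_ball] at hy; rw [← dist_eq_norm, dist_comm] at h1; linarith
  have hApos : 0 < volume A := measure_ball_pos volume y₀ hr0; have hAtop : volume A < ⊤ := measure_ball_lt_top
  have hsqueeze : ∀ T : ℝ, 0 ≤ T →
      volume A ≤ ENNReal.ofReal (C' * (R - 1) ^ (-m) * Real.exp ((3 * γ - c₁ * m) * T)) := by
    intro T hT
    set C₁ : ℝ := max K₁ 0 with hC₁
    have hC₁0 : 0 ≤ C₁ := le_max_right _ _
    set Rbig : ℝ := (R + 1) * Real.exp (C₁ * T) + 2 with hRbig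
    have hRbig0 : 0 < Rbig := by rw [hRbig]; positivity
    obtain ⟨V, hV2, ⟨M, hM⟩, hsmul, ⟨K, hK⟩, hVU⟩ := exists_cutoff_local_smul hprof.contDiff_velocity hRbig0
    have hV1 : ContDiff ℝ 1 V := hV2.of_le (by norm_num)
    set Φ : ℝ → EuclideanSpace ℝ (Fin 3) → EuclideanSpace ℝ (Fin 3) :=
      ODE.evolutionMap (fun _ : ℝ => selfSimilarTransport γ 0 V) 0 with hΦ
    have hflow_add : ∀ (s t : ℝ) (y : EuclideanSpace ℝ (Fin 3)), Φ (s + t) y = Φ s (Φ t y) :=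
      fun s t y => C2.Kelvin.flow_add (γ := γ) hV1 hK s t y
    have hY : ∀ y t, HasDerivAt (fun r => Φ (-r) y) ((-1 : ℝ) • selfSimilarTransport γ 0 V (Φ (-t) y)) t :=
      fun y t => C2.Kelvin.hasDerivAt_flow_neg (γ := γ) hV1 hK y t
    have hWU : ∀ z : EuclideanSpace ℝ (Fin 3), ‖z‖ < Rbig → selfSimilarTransport γ 0 V z = selfSimilarTransport γ 0 U z := by
      intro z hz
      simp only [selfSimilarTransport_apply, hVU z (mem_ball_zero_iff.2 hz)]
    have horbit : ∀ y ∈ A, ∀ t ∈ Icc 0 T,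
        ‖y‖ * Real.exp (c₁ * t) ≤ ‖Φ (-t) y‖ ∧ ‖Φ (-t) y‖ ≤ ‖y‖ * Real.exp (C₁ * t) ∧ h < Hb (Φ (-t) y) := by
      intro y hy
      have hy1 : 1 ≤ ‖y‖ := hR1.trans (hAR y hy).le
      have hyR₀ : R₀ ≤ ‖y‖ := hRR₀.trans (hAR y hy).le
      have hyR1 : ‖y‖ ≤ R + 1 := by
        rw [hA, mem_ball] at hy
        have h1 : ‖y‖ - ‖y₀‖ ≤ ‖y - y₀‖ := norm_sub_norm_le y y₀
        rw [← dist_eq_norm] at h1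
        linarith
      set Y : ℝ → EuclideanSpace ℝ (Fin 3) := fun t => Φ (-t) y with hYdef
      have hY0 : Y 0 = y := by simp [hYdef, hΦ, ODE.evolutionMap_self]
      have hYc : Continuous Y := continuous_iff_continuousAt.2 fun t => (hY y t).continuousAt
      have hgood : ∀ t, 0 ≤ t → t ≤ T → (∀ s ∈ Icc 0 t, ‖y‖ ≤ ‖Y s‖ ∧ ‖Y s‖ ≤ Rbig - 1) →
          ∀ s ∈ Icc 0 t, ‖y‖ * Real.exp (c₁ * s) ≤ ‖Y s‖ ∧ ‖Y s‖ ≤ ‖y‖ * Real.exp (C₁ * s) ∧ h < Hb (Y s) ∧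
            ⟪Y s, selfSimilarTransport γ 0 V (Y s)⟫ ≤ -(c₁ * ‖Y s‖ ^ 2) := by
        intro t ht0 htT hg
        -- inside the big ball, where the cut-off field is the profile field
        have hin : ∀ s ∈ Icc 0 t, ‖Y s‖ < Rbig := fun s hs => by linarith [(hg s hs).2]
        have hYU : ∀ s ∈ Icc 0 t, HasDerivAt Y ((-1 : ℝ) • selfSimilarTransport γ 0 U (Y s)) s := by
          intro s hs
          have h1 := hY y s
          rw [hWU _ (hin s hs)] at h1
          exact h1
        -- `ℋ` is non-decreasing along the (true) backward orbit: the orbit stays in `Θ_h`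
        have hH : ∀ s ∈ Icc 0 t, h < Hb (Y s) := by
          intro s hs
          have h1 := selfSimilarBernoulli_monotone_backward hprof hγ2' hs.1
            (fun σ hσ => hYU σ ⟨hσ.1, hσ.2.trans hs.2⟩)
          rw [hY0] at h1
          exact lt_of_lt_of_le (hAh y hy) h1
        -- the orbit stays VORTICAL: the weighted vorticity solves a linear ODE along the true orbit
        have hvort : ∀ s ∈ Icc 0 t, curl U (Y s) ≠ 0 := by
          intro s₁ hs₁ hzero
          set Acl : ℝ → EuclideanSpace ℝ (Fin 3) →L[ℝ] EuclideanSpace ℝ (Fin 3) :=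
            fun σ => (-1 : ℝ) • fderiv ℝ (selfSimilarTransport γ 0 U) (Y σ) with hAcl
          set w : ℝ → EuclideanSpace ℝ (Fin 3) := fun σ => Real.exp ((-1 : ℝ) * (1 + γ) * σ) • curl U (Y σ) with hw
          have hw' : ∀ σ ∈ Icc 0 s₁, HasDerivAt w (Acl σ (w σ)) σ := fun σ hσ =>
            hasDerivAt_weightedCurl_comp hprof (hYU σ ⟨hσ.1, hσ.2.trans hs₁.2⟩)
          -- a uniform bound of `‖Acl σ‖` on the compact time interval
          have hAc : Continuous fun σ => Acl σ := by
            have h1 : Continuous fun σ => fderiv ℝ (selfSimilarTransport γ 0 U) (Y σ) :=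
              (continuous_fderiv_transport hprof).comp hYc
            exact h1.const_smul (-1 : ℝ)
          obtain ⟨Kb, hKb⟩ := (isCompact_Icc (a := (0 : ℝ)) (b := s₁)).exists_bound_of_continuousOn hAc.continuousOn
          have hKV : ∀ σ ∈ Icc 0 s₁, LipschitzOnWith (Real.toNNReal Kb)
              (fun z : EuclideanSpace ℝ (Fin 3) => Acl σ z) univ := by
            intro σ hσ
            refine ((Acl σ).lipschitz.weaken ?_).lipschitzOnWith
            rw [← NNReal.coe_le_coe, coe_nnnorm, Real.coe_toNNReal _ ((norm_nonneg _).trans (hKb σ hσ))]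
            exact hKb σ hσ
          have hwc : ContinuousOn w (Icc 0 s₁) := fun σ hσ => (hw' σ hσ).continuousAt.continuousWithinAt
          have hws₁ : w s₁ = 0 := by simp [hw, hzero]
          have hEq : EqOn w (fun _ => (0 : EuclideanSpace ℝ (Fin 3))) (Icc 0 s₁) :=
            ODE_solution_unique_of_mem_Icc_left (v := fun σ z => Acl σ z) (s := fun _ => univ)
              (fun σ hσ => hKV σ (Ioc_subset_Icc_self hσ)) hwc
              (fun σ hσ => (hw' σ (Ioc_subset_Icc_self hσ)).hasDerivWithinAt) (fun _ _ => mem_univ _)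
              continuousOn_const
              (fun σ _ => by
                have h0 : HasDerivWithinAt (fun _ : ℝ => (0 : EuclideanSpace ℝ (Fin 3))) 0 (Iic σ) σ :=
                  hasDerivWithinAt_const _ _ _
                simpa using h0)
              (fun _ _ => mem_univ _) (by simpa using hws₁)
          have hw0 : w 0 = 0 := hEq ⟨le_rfl, hs₁.1⟩
          have : curl U y = 0 := by simpa [hw, hY0] using hw0
          exact hAcurl y hy this
        -- the PINCHED channel applies along the true, vortical, Bernoulli-high, far orbit: it escapes, but not too fast
        have hch2 : ∀ s ∈ Icc 0 t, ⟪Y s, selfSimilarTransport γ 0 V (Y s)⟫ ≤ -(c₁ * ‖Y s‖ ^ 2) ∧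
            -(C₁ * ‖Y s‖ ^ 2) ≤ ⟪Y s, selfSimilarTransport γ 0 V (Y s)⟫ := by
          intro s hs
          rw [hWU _ (hin s hs)]
          obtain ⟨h1, h2⟩ := hfastR (Y s) (hyR₀.trans (hg s hs).1) (hH s hs) (hvort s hs)
          refine ⟨h1, le_trans ?_ h2⟩
          have h3 : K₁ * ‖Y s‖ ^ 2 ≤ C₁ * ‖Y s‖ ^ 2 := mul_le_mul_of_nonneg_right (le_max_left _ _) (sq_nonneg _)
          linarith
        have hch : ∀ s ∈ Icc 0 t, ⟪Y s, selfSimilarTransport γ 0 V (Y s)⟫ ≤ -(c₁ * ‖Y s‖ ^ 2) :=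
          fun s hs => (hch2 s hs).1
        have hup : ∀ s ∈ Icc 0 t, ‖Y s‖ ≤ ‖y‖ * Real.exp (C₁ * s) := by
          intro s hs
          have h1 := norm_le_mul_exp_of_inflow_ge (γ := γ) (V := V) (Y := Y) ht0
            (fun σ _ => hY y σ) (fun σ hσ => (hch2 σ hσ).2) s hs
          simpa [hY0] using h1
        have hlow : ∀ s ∈ Icc 0 t, ‖y‖ * Real.exp (c₁ * s) ≤ ‖Y s‖ := by
          intro s hs
          have h1 := norm_ge_mul_exp_of_fastInflow (γ := γ) (V := V) (Y := Y) ht0 (fun σ _ => hY y σ) hch s hs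
          simpa [hY0] using h1
        exact fun s hs => ⟨hlow s hs, hup s hs, hH s hs, hch s hs⟩
      -- (ii) `good T` by a first-exit argument (goodness = not closer than `‖y‖` AND inside the ball `‖·‖ ≤ Rbig − 1`)
      have hyRbig : ‖y‖ ≤ Rbig - 2 := by
        have h1 : 1 ≤ Real.exp (C₁ * T) := Real.one_le_exp (mul_nonneg hC₁0 hT)
        rw [hRbig]; nlinarith [hyR1, norm_nonneg y]
      have hgoodT : ∀ s ∈ Icc 0 T, ‖y‖ ≤ ‖Y s‖ ∧ ‖Y s‖ ≤ Rbig - 1 := by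
        by_contra hbad
        set B : Set ℝ := {s | s ∈ Icc 0 T ∧ ¬(‖y‖ ≤ ‖Y s‖ ∧ ‖Y s‖ ≤ Rbig - 1)} with hB
        have hBne : B.Nonempty := by
          by_contra hemp
          apply hbad
          intro s hs
          by_contra hnot
          exact hemp ⟨s, hs, hnot⟩
        have hBbdd : BddBelow B := ⟨0, fun s hs => hs.1.1⟩
        set t₀ : ℝ := sInf B with ht₀
        have ht₀mem : ∀ s ∈ B, t₀ ≤ s := fun s hs => csInf_le hBbdd hs
        have ht₀0 : 0 ≤ t₀ := le_csInf hBne fun s hs => hs.1.1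
        have ht₀T : t₀ ≤ T := by obtain ⟨s, hs⟩ := hBne; exact (ht₀mem s hs).trans hs.1.2
        -- before `t₀` the orbit is good
        have hbefore : ∀ s ∈ Icc 0 T, s < t₀ → ‖y‖ ≤ ‖Y s‖ ∧ ‖Y s‖ ≤ Rbig - 1 := by
          intro s hs hst
          by_contra hnot
          exact absurd (ht₀mem s ⟨hs, hnot⟩) (not_le.2 hst)
        -- hence also at `t₀` (continuity), so `good t₀`
        have hgood₀ : ∀ s ∈ Icc 0 t₀, ‖y‖ ≤ ‖Y s‖ ∧ ‖Y s‖ ≤ Rbig - 1 := by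
          intro s hs
          rcases eq_or_lt_of_le hs.2 with heq | hlt
          · -- at `t₀` itself: limit from the left (or `t₀ = 0`)
            rw [heq]
            rcases eq_or_lt_of_le ht₀0 with h00 | h0pos
            · rw [← h00, hY0]; exact ⟨le_rfl, by linarith⟩
            · have hcl : ‖Y t₀‖ ∈ closure ((fun σ => ‖Y σ‖) '' Ico 0 t₀) := by
                have hct : ContinuousWithinAt (fun σ => ‖Y σ‖) (Ico 0 t₀) t₀ :=
                  (hYc.norm.continuousAt).continuousWithinAt
                have hmem : t₀ ∈ closure (Ico 0 t₀) := by
                  rw [closure_Ico h0pos.ne]; exact right_mem_Icc.2 ht₀0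
                exact hct.mem_closure_image hmem
              have hsub : (fun σ => ‖Y σ‖) '' Ico 0 t₀ ⊆ Icc ‖y‖ (Rbig - 1) := by
                rintro _ ⟨σ, hσ, rfl⟩
                exact hbefore σ ⟨hσ.1, hσ.2.le.trans ht₀T⟩ hσ.2
              have hx := closure_mono hsub hcl
              rw [closure_Icc, mem_Icc] at hx
              exact hx
          · exact hbefore s ⟨hs.1, hlt.le.trans ht₀T⟩ hlt
        obtain ⟨hlow₀, hup₀, -, hch₀⟩ := hgood t₀ ht₀0 ht₀T hgood₀ t₀ ⟨ht₀0, le_rfl⟩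
        -- the strict channel inequality at `t₀` persists a little beyond `t₀`
        have hYt₀1 : 1 ≤ ‖Y t₀‖ := hy1.trans (hgood₀ t₀ ⟨ht₀0, le_rfl⟩).1
        have hYt₀pos : 0 < ‖Y t₀‖ := by linarith
        have hcont : Continuous fun σ => ⟪Y σ, selfSimilarTransport γ 0 V (Y σ)⟫ + c₁ / 2 * ‖Y σ‖ ^ 2 := by
          have hWc : Continuous (selfSimilarTransport γ 0 V) :=
            (PowerGaugeEulerLiouville.Kelvin.contDiff_selfSimilarTransport (γ := γ) hV1).continuous
          exact (hYc.inner (hWc.comp hYc)).add (continuous_const.mul (hYc.norm.pow 2))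
        have hneg : ⟪Y t₀, selfSimilarTransport γ 0 V (Y t₀)⟫ + c₁ / 2 * ‖Y t₀‖ ^ 2 < 0 := by
          have : 0 < c₁ / 2 * ‖Y t₀‖ ^ 2 := by positivity
          linarith
        obtain ⟨δ, hδ, hδball⟩ := Metric.continuousAt_iff.1 hcont.continuousAt
          (-(⟪Y t₀, selfSimilarTransport γ 0 V (Y t₀)⟫ + c₁ / 2 * ‖Y t₀‖ ^ 2)) (by linarith)
        have hch' : ∀ σ ∈ Icc t₀ (t₀ + δ / 2), ⟪Y σ, selfSimilarTransport γ 0 V (Y σ)⟫ ≤ -(c₁ / 2 * ‖Y σ‖ ^ 2) := by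
          intro σ hσ
          have hd : dist σ t₀ < δ := by
            rw [Real.dist_eq, abs_of_nonneg (by linarith [hσ.1])]; linarith [hσ.2]
          have h1 := hδball hd
          rw [Real.dist_eq, abs_lt] at h1
          linarith [h1.2]
        have hesc : ∀ σ ∈ Icc t₀ (t₀ + δ / 2), ‖Y t₀‖ ≤ ‖Y σ‖ := by
          intro σ hσ
          have h1 := norm_ge_mul_exp_of_fastInflow (γ := γ) (V := V) (Y := Y) (c₁ := c₁ / 2) (by linarith : t₀ ≤ t₀ + δ / 2)
            (fun σ' _ => hY y σ') hch' σ hσ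
          have h2 : 1 ≤ Real.exp (c₁ / 2 * (σ - t₀)) := Real.one_le_exp (by nlinarith [hσ.1])
          nlinarith [norm_nonneg (Y t₀)]
        -- the orbit is still deep inside the big ball at `t₀`, hence shortly after
        have hYt₀big : ‖Y t₀‖ ≤ Rbig - 2 := by
          have h1 : Real.exp (C₁ * t₀) ≤ Real.exp (C₁ * T) :=
            Real.exp_le_exp.2 (mul_le_mul_of_nonneg_left ht₀T hC₁0)
          have h2 : ‖y‖ * Real.exp (C₁ * t₀) ≤ (R + 1) * Real.exp (C₁ * T) :=
            mul_le_mul hyR1 h1 (Real.exp_pos _).le (by linarith)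
          rw [hRbig]; linarith [hup₀]
        obtain ⟨δ', hδ', hδ'ball⟩ := Metric.continuousAt_iff.1 hYc.norm.continuousAt 1 one_pos
        have hinside : ∀ σ, dist σ t₀ < δ' → ‖Y σ‖ ≤ Rbig - 1 := by
          intro σ hσ
          have h1 := hδ'ball hσ
          rw [Real.dist_eq, abs_lt] at h1
          linarith [h1.2]
        -- no bad time in `[t₀, t₀ + δ₂]`, none before `t₀`: contradiction with `t₀ = inf B`
        set δ₂ : ℝ := min (δ / 2) (δ' / 2) with hδ₂
        have hδ₂0 : 0 < δ₂ := by rw [hδ₂]; positivity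
        have hlb : ∀ s ∈ B, t₀ + δ₂ ≤ s := by
          intro s hs
          by_contra hlt
          push Not at hlt
          have hst₀ : t₀ ≤ s := ht₀mem s hs
          have hs1 : s ≤ t₀ + δ / 2 := by linarith [min_le_left (δ / 2) (δ' / 2)]
          have hs2 : dist s t₀ < δ' := by
            rw [Real.dist_eq, abs_of_nonneg (by linarith)]; linarith [min_le_right (δ / 2) (δ' / 2)]
          have h1 : ‖y‖ ≤ ‖Y s‖ := (hgood₀ t₀ ⟨ht₀0, le_rfl⟩).1.trans (hesc s ⟨hst₀, hs1⟩)
          exact hs.2 ⟨h1, hinside s hs2⟩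
        have : t₀ + δ₂ ≤ t₀ := le_csInf hBne hlb
        linarith
      intro t ht
      obtain ⟨h1, h2, h3, -⟩ := hgood T hT le_rfl hgoodT t ht
      exact ⟨h1, h2, h3⟩
    set B' : Set (EuclideanSpace ℝ (Fin 3)) := Φ T ⁻¹' A with hB'
    have hΦTc : Continuous (Φ T) := (C2.Kelvin.contDiff_flow (γ := γ) hV2 hK T).continuous
    have hB'm : MeasurableSet B' := hΦTc.measurable hAm
    have hΦinv : ∀ y, Φ T (Φ (-T) y) = y := by
      intro y
      have h1 := hflow_add T (-T) y
      rw [add_neg_cancel] at h1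
      rw [← h1]; exact ODE.evolutionMap_self _ 0 y
    have hΦinv' : ∀ z, Φ (-T) (Φ T z) = z := by
      intro z
      have h1 := hflow_add (-T) T z
      rw [neg_add_cancel] at h1
      rw [← h1]; exact ODE.evolutionMap_self _ 0 z
    have hB'eq : ∀ z, z ∈ B' ↔ ∃ y ∈ A, z = Φ (-T) y := by
      intro z
      constructor
      · intro hz; exact ⟨Φ T z, hz, (hΦinv' z).symm⟩
      · rintro ⟨y, hy, rfl⟩
        show Φ T (Φ (-T) y) ∈ A
        rw [hΦinv y]; exact hy
    have himage : Φ T '' B' = A := by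
      ext y
      constructor
      · rintro ⟨z, hz, rfl⟩; exact hz
      · intro hy; exact ⟨Φ (-T) y, by show Φ T (Φ (-T) y) ∈ A; rw [hΦinv y]; exact hy, hΦinv y⟩
    -- forward orbits of `B'` stay in the ball `‖z‖ ≤ Rbig − 1` on `[0,T]`
    have hstay : ∀ z ∈ B', ∀ σ ∈ Icc 0 T, ‖Φ σ z‖ ≤ Rbig - 1 := by
      intro z hz σ hσ
      obtain ⟨y, hy, rfl⟩ := (hB'eq z).1 hz
      have h1 : Φ σ (Φ (-T) y) = Φ (-(T - σ)) y := by
        rw [← hflow_add σ (-T) y]; congr 1; ring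
      rw [h1]
      obtain ⟨-, hup, -⟩ := horbit y hy (T - σ) ⟨by linarith [hσ.2], by linarith [hσ.1]⟩
      have hyR1 : ‖y‖ ≤ R + 1 := by
        rw [hA, mem_ball] at hy
        have h1 : ‖y‖ - ‖y₀‖ ≤ ‖y - y₀‖ := norm_sub_norm_le y y₀
        rw [← dist_eq_norm] at h1
        linarith
      have h2 : Real.exp (C₁ * (T - σ)) ≤ Real.exp (C₁ * T) :=
        Real.exp_le_exp.2 (mul_le_mul_of_nonneg_left (by linarith [hσ.1]) hC₁0)
      have h3 : ‖y‖ * Real.exp (C₁ * (T - σ)) ≤ (R + 1) * Real.exp (C₁ * T) :=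
        mul_le_mul hyR1 h2 (Real.exp_pos _).le (by linarith)
      rw [hRbig]; linarith
    have hdiv : ∀ z : EuclideanSpace ℝ (Fin 3), ‖z‖ ≤ Rbig - 1 → VectorCalculus.divergence V z = 0 := by
      intro z hz
      have hzball : z ∈ ball (0 : EuclideanSpace ℝ (Fin 3)) Rbig := mem_ball_zero_iff.2 (by linarith)
      have hev : V =ᶠ[𝓝 z] U := by
        filter_upwards [isOpen_ball.mem_nhds hzball] with w hw using hVU w hw
      unfold VectorCalculus.divergence
      rw [hev.fderiv_eq]
      exact hprof.divFree z
    have hvol : volume A = ENNReal.ofReal (Real.exp (3 * γ * T)) * volume B' := by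
      rw [← himage]
      exact volume_image_flow_eq_exp_of_stay (γ := γ) hV2 hK hT hdiv hB'm hstay
    have hB'sub : B' ⊆ {z | h < Hb z} ∩ {z | (R - 1) * Real.exp (c₁ * T) ≤ ‖z‖} := by
      intro z hz
      obtain ⟨y, hy, rfl⟩ := (hB'eq z).1 hz
      obtain ⟨hlow, -, hH⟩ := horbit y hy T ⟨hT, le_rfl⟩
      refine ⟨hH, ?_⟩
      show (R - 1) * Real.exp (c₁ * T) ≤ ‖Φ (-T) y‖
      exact (mul_le_mul_of_nonneg_right (hAR y hy).le (Real.exp_pos _).le).trans hlow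
    have hfarR : R₂ ≤ (R - 1) * Real.exp (c₁ * T) := by
      have h1 : 1 ≤ Real.exp (c₁ * T) := Real.one_le_exp (by positivity)
      nlinarith
    have hB'vol : volume B' ≤ ENNReal.ofReal (C' * ((R - 1) * Real.exp (c₁ * T)) ^ (-m)) :=
      (measure_mono hB'sub).trans (hthinR' _ hfarR)
    calc volume A = ENNReal.ofReal (Real.exp (3 * γ * T)) * volume B' := hvol
      _ ≤ ENNReal.ofReal (Real.exp (3 * γ * T)) * ENNReal.ofReal (C' * ((R - 1) * Real.exp (c₁ * T)) ^ (-m)) :=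
          mul_le_mul' le_rfl hB'vol
      _ = ENNReal.ofReal (C' * (R - 1) ^ (-m) * Real.exp ((3 * γ - c₁ * m) * T)) := by
          rw [← ENNReal.ofReal_mul (Real.exp_pos _).le]
          congr 1
          have := rpow_mul_exp_neg_mul_exp (c₁ := c₁) (m := m) (γ := γ) (T := T) hR0
          calc Real.exp (3 * γ * T) * (C' * ((R - 1) * Real.exp (c₁ * T)) ^ (-m))
              = C' * (Real.exp (3 * γ * T) * ((R - 1) * Real.exp (c₁ * T)) ^ (-m)) := by ring
            _ = C' * ((R - 1) ^ (-m) * Real.exp ((3 * γ - c₁ * m) * T)) := by rw [this]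
            _ = C' * (R - 1) ^ (-m) * Real.exp ((3 * γ - c₁ * m) * T) := by ring
  have hδ : 0 < c₁ * m - 3 * γ := by linarith
  have hA0 : volume A = 0 := by
    by_contra hne
    have hvpos : 0 < (volume A).toReal := ENNReal.toReal_pos hne hAtop.ne
    obtain ⟨T, hT0, hT⟩ := exists_mul_exp_neg_lt (K := C' * (R - 1) ^ (-m)) hδ hvpos
    have h1 := hsqueeze T hT0
    have h2 : C' * (R - 1) ^ (-m) * Real.exp ((3 * γ - c₁ * m) * T) < (volume A).toReal := by
      have : (3 * γ - c₁ * m) * T = -((c₁ * m - 3 * γ) * T) := by ring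
      rw [this]; exact hT
    have h3 : volume A < volume A :=
      lt_of_le_of_lt h1 ((ENNReal.ofReal_lt_ofReal_iff hvpos).2 h2 |>.trans_le (ENNReal.ofReal_toReal hAtop.ne).le)
    exact lt_irrefl _ h3
  exact absurd hA0 hApos.ne'

end Summit.NavierStokesRegularity.NavierStokesRegularity.Theorems.PowerGaugeEulerLiouville.Loc

end
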